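import Literature.MathematicalPhysics.QuantumFieldTheory.Balaban1983to89.B9Thm31CubeLocalFlatMemberGlobal
import Literature.MathematicalPhysics.QuantumFieldTheory.Balaban1983to89.B9Ineq346GpFlatMultiLevelTorus

/-!
# `Balaban1983to89.B9Ineq346CubeLocalFlatMember` — [B9] THEOREM 3.1: THE BLOCK MAJORANTS (2.51) OF THE CUBE-LOCAL LETTER `G′_□(1)` IN THE
# MEMBER'S GEOMETRY (`HasMajorant` over `B6Geom246MultiLevelTorus.geomT D`, the four (3.42) entries — the currency of p21's (3.46)∕(3.47)
# torus files and of def-Y's (2.51) ⇄ (3.42) dictionary), AND THE THREE `L²` MEMBERS OF (3.46) AT `U = 1` FOR `G′_□` that follow by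
# Schur's test (`‖1_{B(y)}G′_□λ‖₂`, `‖1_{B(y)}∂_μG′_□λ‖₂`, `‖1_{B(y)}G′_□∂_μᵀλ‖₂`) — p21's `B9Ineq346GpFlatMultiLevelTorus.l2_block_sq_le` at
# `T := GpCubeW` (sub-row G-B9-LETTERS, module M5.1a, file 2f)

FRAMING (verbatim cell line):
statement-level skeleton of published theorems with citation tags; proofs where landed; nothing here is a claim about the Yang–Mills mass gap

Sources under audit (cell lit-balaban): T. Bałaban, *Propagators for lattice gauge theories in a background field*, Commun. Math. Phys. **99**
(1985) 389–434 [`Balaban1985BackgroundPropagators`, "B9"], Thm 3.1 (3.42) p. 397, (3.46) p. 398, Cor. 3.5 p. 407, p. 409 l. 1–5; T. Bałaban,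
*Propagators and renormalization transformations for lattice gauge theories. II*, Commun. Math. Phys. **96** (1984) 223–250
[`Balaban1984PropagatorsII`, "[4]"], Prop. 2.2 (2.67) p. 234, (2.51) p. 232, (2.46) p. 231.  Unit `lit-balaban-r05` (r05 gen 77).

## WHAT IS PRINTED (verbatim up to notation)

[B9] (3.46) p. 398: «‖hG′(U)λ‖, ‖h∇_UG′(U)λ‖, ‖hG′(U)∇*_Uλ‖, … ≦ B₀[(Lʲη)², Lʲη, Lʲη, …]e^{−δ₀d(y,y′)}‖λ‖ for h with supp h ⊂ Δ̃(y), |h| ≦ 1,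
supp λ ⊂ Δ(y′)» (the `L²` norms); p. 407: at `U = 1` «these theorems are proved in [4]» — [4] prints the sup ∕ Hölder members (2.67) only, the
`L²` members follow by Schur's test from (2.67) for the operator and its transpose (cell GAP G-B9-03a, p21's `B9Ineq346GpFlatMultiLevelTorus`).

## WHAT THIS FILE CERTIFIES (kernel-checked; lattice units; `G′_□ := GpCubeW D q …`, member geometry `geomT D`, member blocks `blkOf D.toDomains`)

* §1 **`hasMajorant_cubeW_member`** — file 2e repackaged: ONE `(δ₀, C, M₀, N₀)` such that for every member and cube (thresholds as in file 2e)
  `G′_□`, `∂_μG′_□`, `G′_□∂_μᵀ`, `(−Δ^{per})G′_□` HAVE THE (2.51)-MAJORANTS `C·[L^{2j}, L^{j}, L^{j}, 1]·e^{−δ₀d(y,y′)}` over the MEMBER's geometry.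
* §2 **(3.46) AT `U = 1` FOR `G′_□`, THREE MEMBERS** (`ineq346_cubeW_member_Gp ∕ _dGp ∕ _Gpd`): for member blocks `y, y′` and `λ = 0` off `B(y′)`:
  `Σ_{x∈B(y)}((G′_□λ)(x))² ≤ C·L^{2j(y)}L^{2j(y′)}e^{−δd(y,y′)}Σλ²`, `Σ_{x∈B(y)}((∂_μG′_□λ)(x))², Σ_{x∈B(y)}((G′_□∂_μᵀλ)(x))² ≤ C·L^{j(y)}L^{j(y′)}e^{−δd}Σλ²`
  — p21's `l2_block_sq_le` with §1 for the operator and, by `G′_□ᵀ = G′_□` (`gmlT_transpose`), for its transpose.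

## HONEST SCOPE

* `U = 1`; the `ΔG′` member of (3.46) and the unions `Δ̃(y)` (p21's `l2_union_sq_le` applies verbatim to §1) are not spelled out here; (3.47) for
  `G′_□` is the next file.  Cube family of file 1 (mass-`a = a₀ = a₁ = 1` floor).
* Nothing is inferred from the manuscript; kernel-checked.  NOT summit progress; the YM mass gap is not proved by any of this.
-/

namespace Literature.MathematicalPhysics.QuantumFieldTheory.Balaban1983to89.B9Ineq346CubeLocalFlatMember

open Literature.MathematicalPhysics.QuantumFieldTheory.Balaban1983to89.B4Reflection242 (boxDom)
open Literature.MathematicalPhysics.QuantumFieldTheory.Balaban1983to89.B6MultiLevelBoxOperator (N0)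
open Literature.MathematicalPhysics.QuantumFieldTheory.Balaban1983to89.B6MultiLevelTorusOperator (perLapT)
open Literature.MathematicalPhysics.QuantumFieldTheory.Balaban1983to89.B6Cover236MultiLevelBlocks (cubes)
open Literature.MathematicalPhysics.QuantumFieldTheory.Balaban1983to89.B6Geom246MultiLevelBox (bset blkOf)
open Literature.MathematicalPhysics.QuantumFieldTheory.Balaban1983to89.B6Geom246MultiLevelTorus (geomT triangle_refl_nonneg_T)
open Literature.MathematicalPhysics.QuantumFieldTheory.Balaban1983to89.B6RandomWalk (HasMajorant BlockSupp)
open Literature.MathematicalPhysics.QuantumFieldTheory.Balaban1983to89.B6Prop22DerivMultiLevelTorus (dT)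
open Literature.MathematicalPhysics.QuantumFieldTheory.Balaban1983to89.B6Prop22AdjMultiLevelTorus (gmlT_transpose)
open Literature.MathematicalPhysics.QuantumFieldTheory.Balaban1983to89.B8Ineq192MultiLevelTorus (symmT)
open Literature.MathematicalPhysics.QuantumFieldTheory.Balaban1983to89.B9Ineq346GpFlatMultiLevelTorus (l2_block_sq_le)
open Literature.MathematicalPhysics.QuantumFieldTheory.Balaban1983to89.B9CubeSequence408 (cubeFam)
open Literature.MathematicalPhysics.QuantumFieldTheory.Balaban1983to89.B9Thm31CubeLocalFlat (GpCubeW wCube)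
open Literature.MathematicalPhysics.QuantumFieldTheory.Balaban1983to89.B9Thm31CubeLocalFlatMemberGlobal (thm31_cubeW_member_global)
open scoped Matrix

variable {d : ℕ}

/-! ## §1 The four (3.42) entries of `G′_□(1)` as block majorants over the member's geometry -/

/-- **THE (2.51)-MAJORANTS OF `G′_□(1)`, `∂_μG′_□(1)`, `G′_□(1)∂_μᵀ`, `(−Δ^{per})G′_□(1)` OVER THE MEMBER'S GEOMETRY** (one set of constants).
[cite: Balaban1985BackgroundPropagators, Thm 3.1 (3.42) p.397 with Cor. 3.5 p.407 and p.409 l.1–5; Balaban1984PropagatorsII, (2.51) p.232, Prop. 2.2 (2.67) p.234] -/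
theorem hasMajorant_cubeW_member (d ℓ : ℕ) (hℓ : 1 ≤ ℓ) :
    ∃ δ₀ C M₀ : ℝ, ∃ N₀ : ℕ, 0 < δ₀ ∧ 0 < C ∧ 0 < M₀ ∧ 0 < N₀ ∧
      ∀ {Mh k R : ℕ} {P : Fin (d + 1) → ℕ} (D : B6MultiLevelTorusOperator.TDomains d ℓ Mh k P R)
        (q : ↥(cubes D.toDomains)) (hL : Odd (ℓ + 1)) (hM : Odd Mh) (hMh : 1 ≤ Mh) (hP : ∀ μ, 1 ≤ P μ),
        3 ≤ Mh → M₀ ≤ ((ℓ : ℝ) + 1) * Mh → 2 * (ℓ + 1) ≤ R → N₀ + 1 ≤ R * ((ℓ + 1) * Mh) → (∀ μ, 4 ≤ P μ) →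
        HasMajorant (g := geomT D) (blkOf D.toDomains) (Matrix.toLin' (GpCubeW D q hL hM hMh hP))
            (fun y y' => C * ((ℓ : ℝ) + 1) ^ (2 * y.1.1) * Real.exp (-(δ₀ * (geomT D).dist y y'))) ∧
        (∀ μ : Fin (d + 1), HasMajorant (g := geomT D) (blkOf D.toDomains)
            (Matrix.toLin' (dT (N0 ℓ Mh k P) μ * GpCubeW D q hL hM hMh hP))
            (fun y y' => C * ((ℓ : ℝ) + 1) ^ y.1.1 * Real.exp (-(δ₀ * (geomT D).dist y y')))) ∧
        (∀ μ : Fin (d + 1), HasMajorant (g := geomT D) (blkOf D.toDomains)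
            (Matrix.toLin' (GpCubeW D q hL hM hMh hP * (dT (N0 ℓ Mh k P) μ).transpose))
            (fun y y' => C * ((ℓ : ℝ) + 1) ^ y.1.1 * Real.exp (-(δ₀ * (geomT D).dist y y')))) ∧
        HasMajorant (g := geomT D) (blkOf D.toDomains) (Matrix.toLin' (perLapT (N0 ℓ Mh k P) * GpCubeW D q hL hM hMh hP))
            (fun y y' => C * Real.exp (-(δ₀ * (geomT D).dist y y'))) := by
  obtain ⟨δ₀, C, M₀, N₀, hδ₀, hC, hM₀, hN₀, h⟩ := thm31_cubeW_member_global d ℓ hℓ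
  refine ⟨δ₀, C, M₀, N₀, hδ₀, hC, hM₀, hN₀, ?_⟩
  intro Mh k R P D q hL hM hMh hP h3 hM0 hR hN0 hP4
  have H := h D q hL hM hMh hP h3 hM0 hR hN0 hP4
  refine ⟨fun y' μ B hμ x => ?_, fun ν y' μ B hμ x => ?_, fun ν y' μ B hμ x => ?_, fun y' μ B hμ x => ?_⟩
  · rw [Matrix.toLin'_apply]; exact (H y' μ B hμ x).1
  · rw [Matrix.toLin'_apply]; exact (H y' μ B hμ x).2.1 ν
  · rw [Matrix.toLin'_apply]; exact (H y' μ B hμ x).2.2.1 ν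
  · rw [Matrix.toLin'_apply]; exact (H y' μ B hμ x).2.2.2

/-! ## §2 The `L²` members (3.46) at `U = 1` for `G′_□` -/

/-- **(3.46) AT `U = 1` FOR `G′_□`, THE `G′` MEMBER**: `Σ_{x∈B(y)}((G′_□λ)(x))² ≤ C·L^{2j(y)}·L^{2j(y′)}·e^{−δd(y,y′)}·Σλ²` for `λ = 0` off
`B(y′)` (rows and, by `G′_□ᵀ = G′_□`, columns from §1). [cite: Balaban1985BackgroundPropagators, (3.46) p.398 (first member) with Cor. 3.5 p.407 and p.409 l.1–5; Balaban1984PropagatorsII, Prop. 2.2 (2.67) p.234] -/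
theorem ineq346_cubeW_member_Gp (d ℓ : ℕ) (hℓ : 1 ≤ ℓ) :
    ∃ δ C M₀ : ℝ, ∃ N₀ : ℕ, 0 < δ ∧ 0 < C ∧ 0 < M₀ ∧ 0 < N₀ ∧
      ∀ {Mh k R : ℕ} {P : Fin (d + 1) → ℕ} (D : B6MultiLevelTorusOperator.TDomains d ℓ Mh k P R)
        (q : ↥(cubes D.toDomains)) (hL : Odd (ℓ + 1)) (hM : Odd Mh) (hMh : 1 ≤ Mh) (hP : ∀ μ, 1 ≤ P μ),
        3 ≤ Mh → M₀ ≤ ((ℓ : ℝ) + 1) * Mh → 2 * (ℓ + 1) ≤ R → N₀ + 1 ≤ R * ((ℓ + 1) * Mh) → (∀ μ, 4 ≤ P μ) →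
        ∀ (y y' : ↥(bset D.toDomains)) (lam : ↥(boxDom (N0 ℓ Mh k P)) → ℝ),
          (∀ z, blkOf D.toDomains z ≠ y' → lam z = 0) →
          ∑ x ∈ Finset.univ.filter (fun x => blkOf D.toDomains x = y), ((GpCubeW D q hL hM hMh hP *ᵥ lam) x) ^ 2
            ≤ C * ((ℓ : ℝ) + 1) ^ (2 * y.1.1) * ((ℓ : ℝ) + 1) ^ (2 * y'.1.1) *
              Real.exp (-(δ * (geomT D).dist y y')) * ∑ z, lam z ^ 2 := by
  obtain ⟨δ₀, C₀, M₀, N₀, hδ₀, hC₀, hM₀, hN₀, h⟩ := hasMajorant_cubeW_member d ℓ hℓ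
  refine ⟨δ₀ + δ₀, C₀ * C₀, M₀, N₀, by positivity, by positivity, hM₀, hN₀, ?_⟩
  intro Mh k R P D q hL hM hMh hP h3 hM0 hR hN0 hP4 y y' lam hlam
  obtain ⟨hG, -, -, -⟩ := h D q hL hM hMh hP h3 hM0 hR hN0 hP4
  have hGt : HasMajorant (g := geomT D) (blkOf D.toDomains) (Matrix.toLin' (GpCubeW D q hL hM hMh hP)ᵀ)
      (fun y y' => C₀ * ((ℓ : ℝ) + 1) ^ (2 * y.1.1) * Real.exp (-(δ₀ * (geomT D).dist y y'))) := by
    unfold GpCubeW; rw [gmlT_transpose]; exact hG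
  have hh := l2_block_sq_le D hG hGt y y' (by positivity) (by positivity) lam hlam
  rw [symmT D y' y] at hh
  calc _ ≤ _ := hh
    _ = C₀ * C₀ * ((ℓ : ℝ) + 1) ^ (2 * y.1.1) * ((ℓ : ℝ) + 1) ^ (2 * y'.1.1)
          * (Real.exp (-(δ₀ * (geomT D).dist y y')) * Real.exp (-(δ₀ * (geomT D).dist y y')))
          * ∑ z, lam z ^ 2 := by ring
    _ = _ := by rw [← Real.exp_add]; ring_nf

/-- **(3.46) AT `U = 1` FOR `G′_□`, THE `∇G′` MEMBER**: `Σ_{x∈B(y)}((∂_μG′_□λ)(x))² ≤ C·L^{j(y)}·L^{j(y′)}·e^{−δd(y,y′)}·Σλ²` for `λ = 0` off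
`B(y′)` (rows from the second entry, columns from `(∂_μG′_□)ᵀ = G′_□∂_μᵀ` and the third entry). [cite: Balaban1985BackgroundPropagators, (3.46) p.398 («Lʲη» member) with Cor. 3.5 p.407 and p.409 l.1–5; Balaban1984PropagatorsII, Prop. 2.2 (2.67) p.234 (second and third entries)] -/
theorem ineq346_cubeW_member_dGp (d ℓ : ℕ) (hℓ : 1 ≤ ℓ) :
    ∃ δ C M₀ : ℝ, ∃ N₀ : ℕ, 0 < δ ∧ 0 < C ∧ 0 < M₀ ∧ 0 < N₀ ∧
      ∀ {Mh k R : ℕ} {P : Fin (d + 1) → ℕ} (D : B6MultiLevelTorusOperator.TDomains d ℓ Mh k P R)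
        (q : ↥(cubes D.toDomains)) (hL : Odd (ℓ + 1)) (hM : Odd Mh) (hMh : 1 ≤ Mh) (hP : ∀ μ, 1 ≤ P μ),
        3 ≤ Mh → M₀ ≤ ((ℓ : ℝ) + 1) * Mh → 2 * (ℓ + 1) ≤ R → N₀ + 1 ≤ R * ((ℓ + 1) * Mh) → (∀ μ, 4 ≤ P μ) →
        ∀ (μ : Fin (d + 1)) (y y' : ↥(bset D.toDomains)) (lam : ↥(boxDom (N0 ℓ Mh k P)) → ℝ),
          (∀ z, blkOf D.toDomains z ≠ y' → lam z = 0) →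
          ∑ x ∈ Finset.univ.filter (fun x => blkOf D.toDomains x = y),
              (((dT (N0 ℓ Mh k P) μ * GpCubeW D q hL hM hMh hP) *ᵥ lam) x) ^ 2
            ≤ C * ((ℓ : ℝ) + 1) ^ y.1.1 * ((ℓ : ℝ) + 1) ^ y'.1.1 *
              Real.exp (-(δ * (geomT D).dist y y')) * ∑ z, lam z ^ 2 := by
  obtain ⟨δ₀, C₀, M₀, N₀, hδ₀, hC₀, hM₀, hN₀, h⟩ := hasMajorant_cubeW_member d ℓ hℓ
  refine ⟨δ₀ + δ₀, C₀ * C₀, M₀, N₀, by positivity, by positivity, hM₀, hN₀, ?_⟩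
  intro Mh k R P D q hL hM hMh hP h3 hM0 hR hN0 hP4 μ y y' lam hlam
  obtain ⟨-, hS, hT, -⟩ := h D q hL hM hMh hP h3 hM0 hR hN0 hP4
  have hSt : HasMajorant (g := geomT D) (blkOf D.toDomains)
      (Matrix.toLin' (dT (N0 ℓ Mh k P) μ * GpCubeW D q hL hM hMh hP)ᵀ)
      (fun y y' => C₀ * ((ℓ : ℝ) + 1) ^ y.1.1 * Real.exp (-(δ₀ * (geomT D).dist y y'))) := by
    rw [Matrix.transpose_mul]; unfold GpCubeW; rw [gmlT_transpose]; exact hT μ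
  have hh := l2_block_sq_le D (hS μ) hSt y y' (by positivity) (by positivity) lam hlam
  rw [symmT D y' y] at hh
  calc _ ≤ _ := hh
    _ = C₀ * C₀ * ((ℓ : ℝ) + 1) ^ y.1.1 * ((ℓ : ℝ) + 1) ^ y'.1.1
          * (Real.exp (-(δ₀ * (geomT D).dist y y')) * Real.exp (-(δ₀ * (geomT D).dist y y')))
          * ∑ z, lam z ^ 2 := by ring
    _ = _ := by rw [← Real.exp_add]; ring_nf

/-- **(3.46) AT `U = 1` FOR `G′_□`, THE `G′∇*` MEMBER**: `Σ_{x∈B(y)}((G′_□∂_μᵀλ)(x))² ≤ C·L^{j(y)}·L^{j(y′)}·e^{−δd(y,y′)}·Σλ²` for `λ = 0` off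
`B(y′)` (rows from the third entry, columns from `(G′_□∂_μᵀ)ᵀ = ∂_μG′_□` and the second entry). [cite: Balaban1985BackgroundPropagators, (3.46) p.398 (G′∇* member) with Cor. 3.5 p.407 and p.409 l.1–5; Balaban1984PropagatorsII, Prop. 2.2 (2.67) p.234 (second and third entries)] -/
theorem ineq346_cubeW_member_Gpd (d ℓ : ℕ) (hℓ : 1 ≤ ℓ) :
    ∃ δ C M₀ : ℝ, ∃ N₀ : ℕ, 0 < δ ∧ 0 < C ∧ 0 < M₀ ∧ 0 < N₀ ∧
      ∀ {Mh k R : ℕ} {P : Fin (d + 1) → ℕ} (D : B6MultiLevelTorusOperator.TDomains d ℓ Mh k P R)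
        (q : ↥(cubes D.toDomains)) (hL : Odd (ℓ + 1)) (hM : Odd Mh) (hMh : 1 ≤ Mh) (hP : ∀ μ, 1 ≤ P μ),
        3 ≤ Mh → M₀ ≤ ((ℓ : ℝ) + 1) * Mh → 2 * (ℓ + 1) ≤ R → N₀ + 1 ≤ R * ((ℓ + 1) * Mh) → (∀ μ, 4 ≤ P μ) →
        ∀ (μ : Fin (d + 1)) (y y' : ↥(bset D.toDomains)) (lam : ↥(boxDom (N0 ℓ Mh k P)) → ℝ),
          (∀ z, blkOf D.toDomains z ≠ y' → lam z = 0) →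
          ∑ x ∈ Finset.univ.filter (fun x => blkOf D.toDomains x = y),
              (((GpCubeW D q hL hM hMh hP * (dT (N0 ℓ Mh k P) μ).transpose) *ᵥ lam) x) ^ 2
            ≤ C * ((ℓ : ℝ) + 1) ^ y.1.1 * ((ℓ : ℝ) + 1) ^ y'.1.1 *
              Real.exp (-(δ * (geomT D).dist y y')) * ∑ z, lam z ^ 2 := by
  obtain ⟨δ₀, C₀, M₀, N₀, hδ₀, hC₀, hM₀, hN₀, h⟩ := hasMajorant_cubeW_member d ℓ hℓ
  refine ⟨δ₀ + δ₀, C₀ * C₀, M₀, N₀, by positivity, by positivity, hM₀, hN₀, ?_⟩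
  intro Mh k R P D q hL hM hMh hP h3 hM0 hR hN0 hP4 μ y y' lam hlam
  obtain ⟨-, hS, hT, -⟩ := h D q hL hM hMh hP h3 hM0 hR hN0 hP4
  have hTt : HasMajorant (g := geomT D) (blkOf D.toDomains)
      (Matrix.toLin' (GpCubeW D q hL hM hMh hP * (dT (N0 ℓ Mh k P) μ).transpose)ᵀ)
      (fun y y' => C₀ * ((ℓ : ℝ) + 1) ^ y.1.1 * Real.exp (-(δ₀ * (geomT D).dist y y'))) := by
    rw [Matrix.transpose_mul, Matrix.transpose_transpose]; unfold GpCubeW; rw [gmlT_transpose]; exact hS μ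
  have hh := l2_block_sq_le D (hT μ) hTt y y' (by positivity) (by positivity) lam hlam
  rw [symmT D y' y] at hh
  calc _ ≤ _ := hh
    _ = C₀ * C₀ * ((ℓ : ℝ) + 1) ^ y.1.1 * ((ℓ : ℝ) + 1) ^ y'.1.1
          * (Real.exp (-(δ₀ * (geomT D).dist y y')) * Real.exp (-(δ₀ * (geomT D).dist y y')))
          * ∑ z, lam z ^ 2 := by ring
    _ = _ := by rw [← Real.exp_add]; ring_nf

end Literature.MathematicalPhysics.QuantumFieldTheory.Balaban1983to89.B9Ineq346CubeLocalFlatMember
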